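import Summits.ResolutionOfSingularities.ResolutionOfSingularities.Theorems.EquisingularLiftEquisingularLiftNatSubmaxLinNPrime
import HarnessLib

/-!
# [OURS · EL♮] THE ALL-DIMENSION SUBMAXIMAL FAMILY — THE INTRINSIC HYPOTHESIS: a form of degree `d + 2` in `(x_{r+1}, x_{r+2})^{d+1}` HAS the
# shape `Σ_{j≤r} x_j·A_j(x_{r+1},x_{r+2}) + C(x_{r+1},x_{r+2})`; EL♮ and regular blow-up models for every prime `F ∈ (x_{r+1},x_{r+2})^{deg F − 1}`
# (crux `Theses.EquisingularLift.EquisingularLiftNat`, stmt-ResolutionOfSingularities-20038; blow-up models: stmt-…-15660)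

[OURS · leafhand-res-equisingularlift-7 g0, 2026-08-31; cell `pub/decomp-res`] AI-produced, weaker than expert review; NOT a statement of any
manuscript; nothing here proves resolution of singularities in positive characteristic.  DEF-FREE helper; no `sorry`; standard axioms; ZERO named
hypotheses.  The `r = 1` version is `SubmaxLine.exists_shape_of_mem_pow` (p822585).

* `le_of_mem_span_killed_pow` — `G ∈ (x_{r+1}, x_{r+2})ⁿ` forces `x_{r+1}`-`x_{r+2}`-degree `≥ n` on every monomial;
* ★ `exists_shape_of_mem_powN` — a form of degree `d + 2` in `(x_{r+1}, x_{r+2})^{d+1}` IS `Σ_{j≤r} x_j·A_j + C` (`A_j` binary forms of degree `d + 1`,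
  `C` of degree `d + 2`);
* ★★ `elNatAt_of_prime_of_mem_powN` (any `(H, ι)` with `range ι = V₊(F)`), ★★ `blowupModel_of_range_eq_of_mem_powN` — for every PRIME form `F` of
  degree `d + 2` with `F ∈ (x_{r+1}, x_{r+2})^{d+1}` over `K = K̄`: EL♮ (every `p`) and a regular blow-up model — **every integral hypersurface of `ℙⁿ_K̄`
  whose multiplicity along the coordinate `ℙ^{n−2} = V(x_{n−1}, x_n)` is `≥ deg − 1`.**
-/

set_option linter.dupNamespace false -- mandated namespace `Summit.<Summit>.<Problem>` of this single-conjunct summit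

noncomputable section

open CategoryTheory CategoryTheory.Limits AlgebraicGeometry TopologicalSpace
open MvPolynomial
open scoped Pointwise
open Literature.AlgebraicGeometry.Resolution
open Literature.AlgebraicGeometry.Motives Literature.AlgebraicGeometry.Motives.SmoothHypersurface

namespace Summit.ResolutionOfSingularities.ResolutionOfSingularities.Cruxes.EquisingularLiftNat.Sections

namespace SubmaxLinN

variable (K : Type) [Field K] {r : ℕ}

/-! ## Monomials of the powers of `(x_{r+1}, x_{r+2})` -/

/-- **`G ∈ (x_{r+1}, x_{r+2})ⁿ ⟹ every monomial of `G` has `x_{r+1}`-`x_{r+2}`-degree `≥ n`.** [folklore] -/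
theorem le_of_mem_span_killed_pow (n : ℕ) : ∀ G : MvPolynomial (Fin (r + 1 + 1 + 1)) K,
    G ∈ (Ideal.span {(X (⟨r + 1, by omega⟩ : Fin (r + 1 + 1 + 1)) : MvPolynomial (Fin (r + 1 + 1 + 1)) K),
      X (⟨r + 1 + 1, by omega⟩ : Fin (r + 1 + 1 + 1))}) ^ n →
    ∀ s ∈ G.support, n ≤ s ⟨r + 1, by omega⟩ + s ⟨r + 1 + 1, by omega⟩ := by
  classical
  induction n with
  | zero => intro G _ s _; exact Nat.zero_le _
  | succ n ih =>
    intro G hG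
    rw [pow_succ] at hG
    refine Submodule.mul_induction_on hG ?_ ?_
    · intro m hm x hx s hs
      obtain ⟨a, b, rfl⟩ := Ideal.mem_span_pair.mp hx
      rw [mul_add, ← mul_assoc, ← mul_assoc] at hs
      have key : ∀ (q : MvPolynomial (Fin (r + 1 + 1 + 1)) K) (i : Fin (r + 1 + 1 + 1)),
          (i : ℕ) = r + 1 ∨ (i : ℕ) = r + 1 + 1 → s ∈ (m * q * X i).support →
          n + 1 ≤ s ⟨r + 1, by omega⟩ + s ⟨r + 1 + 1, by omega⟩ := by
        intro q i hi hs'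
        rw [support_mul_X, Finset.mem_map] at hs'
        obtain ⟨t, ht, rfl⟩ := hs'
        have ht' := support_mul m q ht
        rw [Finset.mem_add] at ht'
        obtain ⟨u, hu, v, -, rfl⟩ := ht'
        have hu' := ih m hm u hu
        simp only [addRightEmbedding_apply, Finsupp.coe_add, Pi.add_apply, Finsupp.single_apply, Fin.ext_iff]
        rcases hi with hi | hi <;> simp only [hi] <;> split_ifs <;> omega
      rcases Finset.mem_union.mp (support_add hs) with h2 | h3
      · exact key a _ (Or.inl rfl) h2
      · exact key b _ (Or.inr rfl) h3
    · intro x y hx hy s hs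
      rcases Finset.mem_union.mp (support_add hs) with h | h
      · exact hx s h
      · exact hy s h

/-! ## The shape `Σ_j x_j·A_j + C` -/

/-- Total degree of an exponent on `Fin (r + 3)`: surviving part plus the two killed entries. [folklore] -/
theorem sum_support_eq_split (s : Fin (r + 1 + 1 + 1) →₀ ℕ) :
    ∑ i ∈ s.support, s i = ∑ j : Fin (r + 1), s j.castSucc.castSucc + s ⟨r + 1, by omega⟩ + s ⟨r + 1 + 1, by omega⟩ := by
  classical
  rw [Finset.sum_subset (Finset.subset_univ s.support) (fun i _ hi => Finsupp.notMem_support_iff.mp hi),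
    Fin.sum_univ_castSucc, Fin.sum_univ_castSucc]
  rfl

/-- ★ **A form of degree `d + 2` in `(x_{r+1}, x_{r+2})^{d+1}` has the shape `Σ_{j≤r} x_j·A_j(x_{r+1},x_{r+2}) + C(x_{r+1},x_{r+2})`** with `A_j`
binary forms of degree `d + 1` and `C` a binary form of degree `d + 2` (each monomial has surviving degree `≤ 1`; sort accordingly). [folklore] -/
theorem exists_shape_of_mem_powN {d : ℕ} (F : MvPolynomial (Fin (r + 1 + 1 + 1)) K) (hF : F.IsHomogeneous (d + 2))
    (hmem : F ∈ (Ideal.span {(X (⟨r + 1, by omega⟩ : Fin (r + 1 + 1 + 1)) : MvPolynomial (Fin (r + 1 + 1 + 1)) K),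
      X (⟨r + 1 + 1, by omega⟩ : Fin (r + 1 + 1 + 1))}) ^ (d + 1)) :
    ∃ (A : Fin (r + 1) → MvPolynomial (Fin 2) K) (C : MvPolynomial (Fin 2) K),
      (∀ j, (A j).IsHomogeneous (d + 1)) ∧ C.IsHomogeneous (d + 2) ∧
      F = ∑ j : Fin (r + 1), (X (j.castSucc.castSucc) : MvPolynomial (Fin (r + 1 + 1 + 1)) K) *
          rename (fun b : Fin 2 => (⟨r + 1 + b, by omega⟩ : Fin (r + 1 + 1 + 1))) (A j) +
        rename (fun b : Fin 2 => (⟨r + 1 + b, by omega⟩ : Fin (r + 1 + 1 + 1))) C := by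
  classical
  have hsupp : ∀ s ∈ F.support, d + 1 ≤ s ⟨r + 1, by omega⟩ + s ⟨r + 1 + 1, by omega⟩ := le_of_mem_span_killed_pow K (d + 1) F hmem
  have hdeg : ∀ s ∈ F.support, ∑ j : Fin (r + 1), s j.castSucc.castSucc + s ⟨r + 1, by omega⟩ + s ⟨r + 1 + 1, by omega⟩ = d + 2 :=
    fun s hs => by rw [← sum_support_eq_split, ← hF.degree_eq_sum_deg_support hs]
  have hσ : ∀ s ∈ F.support, ∑ j : Fin (r + 1), s j.castSucc.castSucc ≤ 1 := fun s hs => by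
    have := hsupp s hs; have := hdeg s hs; omega
  -- surviving entries are `≤ 1`, and at most one of them is `1`
  have hle : ∀ s ∈ F.support, ∀ j : Fin (r + 1), s j.castSucc.castSucc ≤ 1 := fun s hs j =>
    (Finset.single_le_sum (f := fun j : Fin (r + 1) => s j.castSucc.castSucc) (fun _ _ => Nat.zero_le _) (Finset.mem_univ j)).trans (hσ s hs)
  have huniq : ∀ s ∈ F.support, ∀ j j' : Fin (r + 1), s j.castSucc.castSucc = 1 → j' ≠ j → s j'.castSucc.castSucc = 0 := by
    intro s hs j j' hj hj'
    have h2 := Finset.sum_le_sum_of_subset_of_nonneg (f := fun j : Fin (r + 1) => s j.castSucc.castSucc)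
      (Finset.subset_univ ({j, j'} : Finset (Fin (r + 1)))) (fun _ _ _ => Nat.zero_le _)
    rw [Finset.sum_pair (Ne.symm hj')] at h2
    have := hσ s hs
    omega
  -- the projection to the killed part, read on `Fin 2`
  let π : (Fin (r + 1 + 1 + 1) →₀ ℕ) → (Fin 2 →₀ ℕ) := fun s =>
    Finsupp.single 0 (s ⟨r + 1, by omega⟩) + Finsupp.single 1 (s ⟨r + 1 + 1, by omega⟩)
  have hκinj : Function.Injective (fun b : Fin 2 => (⟨r + 1 + b, by omega⟩ : Fin (r + 1 + 1 + 1))) := by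
    intro b b' h
    have := congrArg Fin.val h
    simp at this
    exact Fin.ext this
  have hπκ : ∀ s (b : Fin 2), (π s).mapDomain (fun b : Fin 2 => (⟨r + 1 + b, by omega⟩ : Fin (r + 1 + 1 + 1))) ⟨r + 1 + b, by omega⟩ =
      s ⟨r + 1 + b, by omega⟩ := by
    intro s b
    rw [Finsupp.mapDomain_apply hκinj]
    fin_cases b <;> simp [π]
  have hπsurv : ∀ s (j : Fin (r + 1)), (π s).mapDomain (fun b : Fin 2 => (⟨r + 1 + b, by omega⟩ : Fin (r + 1 + 1 + 1))) j.castSucc.castSucc = 0 := by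
    intro s j
    refine Finsupp.mapDomain_notin_range _ _ ?_
    rintro ⟨b, hb⟩
    have := congrArg Fin.val hb
    simp at this
    omega
  have hπdeg : ∀ s, (π s).degree = s ⟨r + 1, by omega⟩ + s ⟨r + 1 + 1, by omega⟩ := by
    intro s
    simp only [π, map_add, Finsupp.degree_single]
  have hren : ∀ s (c : K), rename (fun b : Fin 2 => (⟨r + 1 + b, by omega⟩ : Fin (r + 1 + 1 + 1))) (monomial (π s) c) =
      monomial ((π s).mapDomain (fun b : Fin 2 => (⟨r + 1 + b, by omega⟩ : Fin (r + 1 + 1 + 1)))) c := fun s c => rename_monomial _ _ _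
  have hX : ∀ (i : Fin (r + 1 + 1 + 1)) (m : Fin (r + 1 + 1 + 1) →₀ ℕ) (c : K),
      (X i : MvPolynomial (Fin (r + 1 + 1 + 1)) K) * monomial m c = monomial (Finsupp.single i 1 + m) c := by
    intro i m c
    rw [X, monomial_mul, one_mul]
  -- termwise identities
  have hcase : ∀ s ∈ F.support,
      monomial s (coeff s F) =
        ∑ j : Fin (r + 1), (X (j.castSucc.castSucc) : MvPolynomial (Fin (r + 1 + 1 + 1)) K) *
            rename (fun b : Fin 2 => (⟨r + 1 + b, by omega⟩ : Fin (r + 1 + 1 + 1)))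
              (if s j.castSucc.castSucc = 1 then monomial (π s) (coeff s F) else 0) +
        rename (fun b : Fin 2 => (⟨r + 1 + b, by omega⟩ : Fin (r + 1 + 1 + 1)))
          (if ∀ j : Fin (r + 1), s j.castSucc.castSucc = 0 then monomial (π s) (coeff s F) else 0) := by
    intro s hs
    by_cases hz : ∀ j : Fin (r + 1), s j.castSucc.castSucc = 0
    · have hse : s = (π s).mapDomain (fun b : Fin 2 => (⟨r + 1 + b, by omega⟩ : Fin (r + 1 + 1 + 1))) := by
        refine Finsupp.ext fun i => ?_
        rcases surv_or_killed (r := r) i with ⟨j, rfl⟩ | ⟨b, rfl⟩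
        · rw [hz j, hπsurv]
        · rw [hπκ]
      rw [if_pos hz, Finset.sum_eq_zero (fun j _ => by rw [if_neg (by rw [hz j]; omega), map_zero, mul_zero]), zero_add, hren,
        ← hse]
    · push Not at hz
      obtain ⟨j₀, hj₀⟩ := hz
      have hj₀1 : s j₀.castSucc.castSucc = 1 := by have := hle s hs j₀; omega
      have hse : s = Finsupp.single (j₀.castSucc.castSucc) 1 +
          (π s).mapDomain (fun b : Fin 2 => (⟨r + 1 + b, by omega⟩ : Fin (r + 1 + 1 + 1))) := by
        refine Finsupp.ext fun i => ?_
        rcases surv_or_killed (r := r) i with ⟨j, rfl⟩ | ⟨b, rfl⟩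
        · rw [Finsupp.add_apply, hπsurv, add_zero, Finsupp.single_apply]
          by_cases hjj : j = j₀
          · subst hjj
            rw [if_pos rfl, hj₀1]
          · rw [if_neg (fun h => hjj (Fin.castSucc_injective _ (Fin.castSucc_injective _ h)).symm), huniq s hs j₀ j hj₀1 hjj]
        · rw [Finsupp.add_apply, hπκ, Finsupp.single_apply, if_neg (fun h => by
            have := congrArg Fin.val h
            simp at this
            omega), zero_add]
      rw [if_neg (fun h => hj₀ (h j₀)), map_zero, add_zero, Finset.sum_eq_single j₀]
      · rw [if_pos hj₀1, hren, hX, ← hse]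
      · intro j _ hj
        rw [if_neg (by rw [huniq s hs j₀ j hj₀1 hj]; omega), map_zero, mul_zero]
      · intro h
        exact absurd (Finset.mem_univ j₀) h
  refine ⟨fun j => ∑ s ∈ F.support with s j.castSucc.castSucc = 1, monomial (π s) (coeff s F),
    ∑ s ∈ F.support with (∀ j : Fin (r + 1), s j.castSucc.castSucc = 0), monomial (π s) (coeff s F), ?_, ?_, ?_⟩
  · intro j
    refine IsHomogeneous.sum _ _ _ fun s hs => isHomogeneous_monomial _ ?_
    obtain ⟨hs, hsj⟩ := Finset.mem_filter.mp hs
    rw [hπdeg]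
    have h1 : ∑ j : Fin (r + 1), s j.castSucc.castSucc = 1 := by
      have := hσ s hs
      have := Finset.single_le_sum (f := fun j : Fin (r + 1) => s j.castSucc.castSucc) (fun _ _ => Nat.zero_le _) (Finset.mem_univ j)
      omega
    have := hdeg s hs
    omega
  · refine IsHomogeneous.sum _ _ _ fun s hs => isHomogeneous_monomial _ ?_
    obtain ⟨hs, hs0⟩ := Finset.mem_filter.mp hs
    rw [hπdeg]
    have h0 : ∑ j : Fin (r + 1), s j.castSucc.castSucc = 0 := Finset.sum_eq_zero fun j _ => hs0 j
    have := hdeg s hs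
    omega
  · simp only [map_sum, Finset.mul_sum, Finset.sum_filter]
    rw [Finset.sum_comm, ← Finset.sum_add_distrib]
    conv_lhs => rw [F.as_sum]
    exact Finset.sum_congr rfl fun s hs => hcase s hs

/-! ## The certificates for prime forms in `(x_{r+1}, x_{r+2})^{deg − 1}` -/

section Prime

variable [IsAlgClosed K] {d : ℕ} (F : MvPolynomial (Fin (r + 1 + 1 + 1)) K) (hF : F.IsHomogeneous (d + 2)) (hprime : Prime F)
  (hmem : F ∈ (Ideal.span {(X (⟨r + 1, by omega⟩ : Fin (r + 1 + 1 + 1)) : MvPolynomial (Fin (r + 1 + 1 + 1)) K),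
      X (⟨r + 1 + 1, by omega⟩ : Fin (r + 1 + 1 + 1))}) ^ (d + 1))
  {H : Scheme.{0}} (ι : H ⟶ (projectiveSpace (r + 1 + 1) K).left)
  (hrange : letI := MvPolynomial.gradedAlgebra (σ := Fin (r + 1 + 1 + 1)) (R := K)
    Set.range ι = {x : Proj (homogeneousSubmodule (Fin (r + 1 + 1 + 1)) K) | F ∈ x.asHomogeneousIdeal})

include hF hprime hmem hrange in
/-- ★★ **EL♮ FOR EVERY PRIME FORM `F` OF DEGREE `d + 2` IN `(x_{r+1}, x_{r+2})^{d+1}`, ANY EMBEDDING WITH IMAGE `V₊(F)`, EVERY DIMENSION** —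
`ELNatAt p K (r+2) H ι`, ANY `p` (✓ `exists_shape_of_mem_powN` + ✓ `elNatAt_submaxLinN_of_prime` + ✓ `LinAutTransport.elNatAt_of_range_eq`).
[OURS · lh7] [cite: Hartshorne1977, I Ex. 5.12] -/
theorem elNatAt_of_prime_of_mem_powN (p : ℕ) (hp : p.Prime) [CharP K p] :
    Theorems.EquisingularLift.ELNatAt p K (r + 1 + 1) H ι := by
  letI := MvPolynomial.gradedAlgebra (σ := Fin (r + 1 + 1 + 1)) (R := K)
  obtain ⟨A, C, hA, hC, hFeq⟩ := exists_shape_of_mem_powN K F hF hmem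
  refine LinAutTransport.elNatAt_of_range_eq p K (r + 1 + 1) ι (hypersurfaceι F).left ?_
    (elNatAt_submaxLinN_of_prime K A C hA hC F hFeq p hp hprime)
  rw [hrange]
  exact QuadricELNat.setOf_mem_eq_range_hypersurfaceι (n := r + 1) F

include hF hprime hmem hrange in
/-- ★ The same in the stubs' currency `ELNatConclusionO K (r+2) H ι`. [OURS · lh7] -/
theorem elnatO_of_prime_of_mem_powN (p : ℕ) (hp : p.Prime) [CharP K p] (hι : IsClosedImmersion ι) (hH : IsIntegral H) :
    ELNatConclusionO K (r + 1 + 1) H ι :=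
  RouteCurrency.elnatO_of_elNatAt p hp K (r + 1 + 1) H ι hι hH (elNatAt_of_prime_of_mem_powN K F hF hprime hmem ι hrange p hp)

end Prime

end SubmaxLinN

end Summit.ResolutionOfSingularities.ResolutionOfSingularities.Cruxes.EquisingularLiftNat.Sections

namespace Summit.ResolutionOfSingularities.ResolutionOfSingularities.Cruxes.EquisingularLift.StrataSplit

open Summit.ResolutionOfSingularities.ResolutionOfSingularities.Cruxes.EquisingularLiftNat.Sections

/-- ★★ **Regular blow-up model (crux `EquisingularLift`'s binder shape), every dimension, for every PRIME form `F` of degree `d + 2` in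
`(x_{r+1}, x_{r+2})^{d+1}`** (`k = k̄`): `ι : H ↪ ℙ^{r+2}_k` a closed immersion, `H` integral, `range ι = V₊(F)` ⟹ `∃ 𝔞 ≠ ⊥` on `H` with all
blow-ups regular. [OURS · lh7] [cite: Hartshorne1977, II Cor. 5.16] -/
theorem blowupModel_of_range_eq_of_mem_powN {k : Type} [Field k] [IsAlgClosed k] {r d : ℕ} {H : Scheme.{0}}
    (ι : H ⟶ (projectiveSpace (r + 1 + 1) k).left) [IsClosedImmersion ι] [IsIntegral H]
    (F : MvPolynomial (Fin (r + 1 + 1 + 1)) k) (hF : F.IsHomogeneous (d + 2)) (hprime : Prime F)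
    (hmem : F ∈ (Ideal.span {(X (⟨r + 1, by omega⟩ : Fin (r + 1 + 1 + 1)) : MvPolynomial (Fin (r + 1 + 1 + 1)) k),
      X (⟨r + 1 + 1, by omega⟩ : Fin (r + 1 + 1 + 1))}) ^ (d + 1))
    (hrange : letI := MvPolynomial.gradedAlgebra (σ := Fin (r + 1 + 1 + 1)) (R := k)
      Set.range ι = {x : Proj (homogeneousSubmodule (Fin (r + 1 + 1 + 1)) k) | F ∈ x.asHomogeneousIdeal}) :
    ∃ 𝔞 : H.IdealSheafData, 𝔞 ≠ ⊥ ∧ ∀ (Z : Scheme.{0}) (π : Z ⟶ H), IsBlowup π 𝔞 → Scheme.IsRegular Z := by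
  obtain ⟨A, C, hA, hC, hFeq⟩ := SubmaxLinN.exists_shape_of_mem_powN k F hF hmem
  exact blowupModel_of_range_eq_submaxLinN_of_prime ι A C hA hC F hFeq hprime hrange

end Summit.ResolutionOfSingularities.ResolutionOfSingularities.Cruxes.EquisingularLift.StrataSplit

end
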